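import Mathlib
import Summits.Ventures.PercRepro.TriangleCapBandDeficiency

/-!
# PercRepro — EVERY CELL HAS A DEPTH, AND THE BAND WITHOUT A DEPTH: `j` IS ATTAINED IFF IT IS AT MOST THE EXTREMAL
VALUE AND NEVER STRICTLY BETWEEN THE TOP OF A SUB-BAND AND THE BOTTOM OF THE NEXT (p3, gen 53; part 275)

`exists_depth`: for every `2 ≤ ℓ`, `ℓ + 3 ≤ t` some depth `u₁` satisfies all the hypotheses of part 272's
`band_complete'` — `⌊(t − 1)/3⌋` for `ℓ ≤ 3` (part 270), `⌊(t + 1)/4⌋` for `ℓ ≥ 4`, `t ≥ 11`, `ℓ + ⌊(t + 1)/4⌋ ≤ t`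
(part 274), and `min ⌊(t + 1)/4⌋ ⌊√(2 (t − ℓ))⌋` otherwise (the deficiency form of part 274: `d = t − ℓ` is then
below `⌊(t + 1)/4⌋`, so either candidate satisfies `u₁² + 3 u₁ + 4 ≥ 2 d`).

THE DESCRIPTION WITHOUT A DEPTH (`band_iff_no_gap`, `2 ≤ ℓ ≤ t`, `2 t ≤ s`): the band value `2 j` is attained on
`ℓ + 1 + (s − t)` vertices IFF `2 j + 2 q t ≤ t (t − 1) + ℓ q (q + 1)` (`q = ⌊t/ℓ⌋`, the extremal value of part 247)
AND for no `u`: `2 B(u) + twoW ℓ u < 2 j < 2 B(u + 1)` — `j` is not strictly between the top `B(u) + W(u, ℓ)` of the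
sub-band `u` and the bottom `B(u + 1)` of the next.  (⇐) needs no structure theorem: below the top of the sub-band
`⌊t/2⌋` the largest `u ≤ ⌊t/2⌋` with `B(u) ≤ j` has `j ≤ B(u) + W(u, ℓ)` by the no-gap condition, and the sub-band
is attained (part 272); above it the deep chain (part 268) reaches the extremal value.  (⇒) uses the depth of
`exists_depth`: a gap above the depth contradicts the propagated overlap, a gap below it contradicts the sub-band
placement of part 272 (monotone bottoms and widths).  THE BAND ON `n` VERTICES IS NOW DESCRIBED WITHOUT ANY
PARAMETER: ITS GAPS ARE EXACTLY THE OPEN INTERVALS BETWEEN CONSECUTIVE SUB-BANDS, AND ITS TOP IS THE EXTREMAL VALUE.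
Axioms: standard.
-/

namespace PercRepro

namespace TriangleCap

namespace C047

open Finset

/-- **EVERY CELL HAS A DEPTH:** for `2 ≤ ℓ`, `ℓ + 3 ≤ t` there is `u₁` with `1 ≤ u₁`, `2 u₁ ≤ t`, `ℓ + u₁ ≤ t`, the
overlap `2 B(u₁ + 1) ≤ 2 B(u₁) + twoW ℓ u₁ + 2` and `4 (u₁ − 1) + 3 ≤ t ∨ ℓ u₁ < t`. -/
theorem exists_depth (ℓ t : ℕ) (hℓ : 2 ≤ ℓ) (ht : ℓ + 3 ≤ t) :
    ∃ u₁, 1 ≤ u₁ ∧ 2 * u₁ ≤ t ∧ ℓ + u₁ ≤ t ∧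
      2 * ((u₁ + 1) * (t - u₁ - 2)) ≤ 2 * (u₁ * (t - u₁ - 1)) + twoW ℓ u₁ + 2 ∧
      (4 * (u₁ - 1) + 3 ≤ t ∨ ℓ * u₁ < t) := by
  rcases Nat.lt_or_ge ℓ 4 with hℓ3 | hℓ4
  · -- `ℓ ≤ 3`: the depth `⌊(t − 1)/3⌋`
    have h3 : ℓ * ((t - 1) / 3) ≤ 3 * ((t - 1) / 3) := Nat.mul_le_mul_right _ (by omega)
    refine ⟨(t - 1) / 3, by omega, by omega, by omega, overlap_of_three_le ℓ t _ (by omega), Or.inr (by omega)⟩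
  · by_cases hq : 11 ≤ t ∧ ℓ + (t + 1) / 4 ≤ t
    · -- the depth `⌊(t + 1)/4⌋`
      exact ⟨(t + 1) / 4, by omega, by omega, hq.2, overlap_quarter ℓ t hℓ4 hq.1, Or.inl (by omega)⟩
    · -- the deficiency `d = t − ℓ` is small: `min ⌊(t + 1)/4⌋ ⌊√(2 d)⌋`
      have hd3 : 3 ≤ t - ℓ := by omega
      have hsq := Nat.sqrt_le (2 * (t - ℓ))
      have hsq' := Nat.lt_succ_sqrt (2 * (t - ℓ))
      obtain ⟨r, hr⟩ : ∃ r, Nat.sqrt (2 * (t - ℓ)) = r := ⟨_, rfl⟩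
      rw [hr] at hsq hsq'
      have hr1 : 1 ≤ r := by nlinarith
      have hrd : r ≤ t - ℓ := by nlinarith
      -- the deficiency is below `⌊(t + 1)/4⌋` whenever that depth is not available
      have hdq : t - ℓ + 1 ≤ (t + 1) / 4 ∨ t ≤ 10 := by omega
      refine ⟨min ((t + 1) / 4) r, by omega, by omega, by omega, ?_, Or.inl (by omega)⟩
      apply overlap_of_deficiency ℓ t _ (by omega)
      rcases Nat.lt_or_ge ((t + 1) / 4) r with hlt | hge
      · rw [min_eq_left hlt.le]
        rcases hdq with h | h
        · nlinarith
        · have : (t + 1) / 4 = 2 := by omega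
          rw [this]
          omega
      · rw [min_eq_right hge]
        nlinarith

/-- The width is even. -/
theorem twoW_even (ℓ u : ℕ) : Even (twoW ℓ u) := by
  unfold twoW
  obtain ⟨x, hx⟩ := coll_even u (lfRR (ℓ - 1) 0)
  obtain ⟨y, hy⟩ := Nat.even_mul_succ_self u
  have := coll_le u (lfRR (ℓ - 1) 0)
  have hu1 : u * (u - 1) ≤ u * (u + 1) := Nat.mul_le_mul_left u (by omega)
  exact ⟨y - x + (ℓ - 1 - u), by omega⟩

/-- The sub-band bottoms increase up to `⌊t/2⌋`: `u ≤ u'`, `2 u' ≤ t` ⇒ `B(u) ≤ B(u')`. -/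
theorem bottom_mono (t u u' : ℕ) (h1 : u ≤ u') (h2 : 2 * u' ≤ t) : u * (t - u - 1) ≤ u' * (t - u' - 1) := by
  rcases Nat.eq_or_lt_of_le h1 with rfl | hlt
  · exact le_rfl
  · rcases Nat.eq_zero_or_pos u with rfl | hu0
    · omega
    · obtain ⟨u₀, rfl⟩ : ∃ u₀, u = u₀ + 1 := ⟨u - 1, by omega⟩
      have := subband_bottom_concave t u' u₀ (by omega) (by omega)
      have e : t - (u₀ + 1) - 1 = t - u₀ - 2 := by omega
      rw [e]
      exact this

/-- A sub-band tangent bound (at `q = subQ ℓ u`) is the width bound `2 j ≤ 2 B(u) + twoW ℓ u`. -/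
theorem width_of_tangent (ℓ t u j : ℕ) (hℓ : 2 ≤ ℓ)
    (h : 2 * j + 2 * (subQ ℓ u * u) ≤ 2 * (u * (t - u - 1)) + u * (u + 1) + (ℓ - 1) * (subQ ℓ u * (subQ ℓ u + 1))) :
    2 * j ≤ 2 * (u * (t - u - 1)) + twoW ℓ u := by
  rcases Nat.eq_zero_or_pos u with rfl | hu0
  · have hq : subQ ℓ 0 = 1 := by
      unfold subQ
      rw [Nat.zero_div, max_eq_left (Nat.zero_le 1)]
    rw [hq] at h
    rw [twoW_zero]
    omega
  · have := twoW_eq_subQ ℓ u hℓ hu0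
    omega

/-- **THE BAND WITHOUT A DEPTH:** for `2 ≤ ℓ ≤ t`, `2 t ≤ s`, the band value `2 j` is attained on `ℓ + 1 + (s − t)`
vertices IFF `2 j + 2 (t / ℓ) t ≤ t (t − 1) + ℓ (t / ℓ)(t / ℓ + 1)` and for no `u`,
`2 u (t − u − 1) + twoW ℓ u < 2 j` and `j < (u + 1)(t − u − 2)`. -/
theorem band_iff_no_gap (ℓ s t j : ℕ) (hℓ : 2 ≤ ℓ) (hℓt : ℓ ≤ t) (hs : 2 * t ≤ s) :
    (∃ (H : SimpleGraph (Fin (ℓ + 1 + (s - t)))) (_ : DecidableRel H.Adj), H.CliqueFree 3 ∧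
      H.edgeFinset.card = s ∧ (∃ w, deg H w + t = s) ∧
      ∑ v, deg H v * deg H v + 2 * (t * (s - t - 1)) + 2 * j = s * (s + 1)) ↔
    (2 * j + 2 * (t / ℓ) * t ≤ t * (t - 1) + ℓ * ((t / ℓ) * (t / ℓ + 1)) ∧
      ∀ u, ¬ (2 * (u * (t - u - 1)) + twoW ℓ u < 2 * j ∧ j < (u + 1) * (t - u - 2))) := by
  have hW : Monotone (twoW ℓ) := monotone_nat_of_le_succ (twoW_succ_ge ℓ)
  -- a gap at `u` contradicts the overlap at `u` (parity)
  have hpar : ∀ u, 2 * ((u + 1) * (t - u - 2)) ≤ 2 * (u * (t - u - 1)) + twoW ℓ u + 2 →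
      ¬ (2 * (u * (t - u - 1)) + twoW ℓ u < 2 * j ∧ j < (u + 1) * (t - u - 2)) := by
    intro u hov ⟨h1, h2⟩
    obtain ⟨x, hx⟩ := twoW_even ℓ u
    omega
  constructor
  · rintro ⟨H, _, hfree, hs', ⟨w, hw⟩, hj'⟩
    refine ⟨((vertex_band_extremal ℓ s t (by omega) (by omega) hs).1 H hfree hs' w hw j hj').2.2 hℓt, ?_⟩
    intro u hgap
    rcases Nat.lt_or_ge (ℓ + 2) t with h3 | h2
    · -- `ℓ + 3 ≤ t`: the depth of `exists_depth`
      obtain ⟨u₁, hu1, hut, hℓu, hov, hstruct⟩ := exists_depth ℓ t hℓ (by omega)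
      rcases Nat.lt_or_ge u u₁ with hlt | hge
      · -- a gap below the depth
        have hjB : j < u₁ * (t - u₁ - 1) := by
          have := bottom_mono t (u + 1) u₁ hlt hut
          have e : t - (u + 1) - 1 = t - u - 2 := by omega
          rw [e] at this
          omega
        have hc := (band_complete' ℓ s t u₁ j hℓ hℓt hs hu1 hut hℓu hov hstruct).mp
          ⟨H, inferInstance, hfree, hs', ⟨w, hw⟩, hj'⟩
        rcases hc with ⟨-, u', hu', hlow, hup⟩ | ⟨hge', -⟩
        · have hup' := width_of_tangent ℓ t u' j hℓ hup
          rcases Nat.lt_or_ge u u' with hlt' | hge'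
          · -- `u < u'`: the bottom of `u'` is above `j`
            have := bottom_mono t (u + 1) u' hlt' (by omega)
            have e : t - (u + 1) - 1 = t - u - 2 := by omega
            rw [e] at this
            omega
          · -- `u' ≤ u`: the top of `u` is above `j`
            have hb := bottom_mono t u' u hge' (by omega)
            have hw' := hW hge'
            omega
        · omega
      · exact hpar u (overlap_of_le ℓ t u₁ hov u hge) hgap
    · -- `t ≤ ℓ + 2`: every sub-band overlaps the next from the star on
      have hov0 : 2 * ((0 + 1) * (t - 0 - 2)) ≤ 2 * (0 * (t - 0 - 1)) + twoW ℓ 0 + 2 := by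
        rw [twoW_zero]
        omega
      exact hpar u (overlap_of_le ℓ t 0 hov0 u (Nat.zero_le u)) hgap
  · rintro ⟨hmax, hnogap⟩
    by_cases hcase : 2 * j ≤ 2 * ((t / 2) * (t - t / 2 - 1)) + twoW ℓ (t / 2)
    · -- the largest `u ≤ ⌊t/2⌋` with `B(u) ≤ j` has `j` at most its top
      suffices key : ∀ d, ∀ u, u + d = t / 2 → u * (t - u - 1) ≤ j →
          ∃ (H : SimpleGraph (Fin (ℓ + 1 + (s - t)))) (_ : DecidableRel H.Adj), H.CliqueFree 3 ∧
            H.edgeFinset.card = s ∧ (∃ w, deg H w + t = s) ∧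
            ∑ v, deg H v * deg H v + 2 * (t * (s - t - 1)) + 2 * j = s * (s + 1) by
        exact key (t / 2) 0 (by omega) (by omega)
      intro d
      induction d with
      | zero =>
        intro u hu hj
        rw [Nat.add_zero] at hu
        subst hu
        exact subband_attained' ℓ s t (t / 2) j hℓ (by omega) (by omega) (by omega) hs hj hcase
      | succ d ih =>
        intro u hu hj
        by_cases htop : 2 * j ≤ 2 * (u * (t - u - 1)) + twoW ℓ u
        · rcases Nat.eq_zero_or_pos u with rfl | hu0
          · rw [twoW_zero] at htop
            exact starWitness ℓ s t j (by omega) hs (by omega) (by omega)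
          · exact subband_attained' ℓ s t u j hℓ hu0 (by omega) (by omega) hs hj htop
        · have hnext := hnogap u
          have hB1 : (u + 1) * (t - u - 2) ≤ j := by
            by_contra hcon
            exact hnext ⟨by omega, by omega⟩
          have e : t - (u + 1) - 1 = t - u - 2 := by omega
          exact ih (u + 1) (by omega) (by rw [e]; exact hB1)
    · have := deepTop_le_twoW ℓ t (t / 2)
      exact band_above_half_attained ℓ s t hℓ hℓt hs j (by omega) hmax

end C047

end TriangleCap

end PercRepro
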